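import Summits.PneNP.PneNP.Theses.RootDecompParityCell

/-!
# `RootDecompParityCell.ParityLiftGlue` (stmt-PneNP-30230) — glue of the ExpHorizon split

Node N10 of the decomp-pnenp root-decomposition cell (route `route-PneNP-RootDecompParityCell`)
split its declared residual `ParityLift` («NP ⊆ P → ⊕P ⊆ P», stmt-PneNP-27750) along the horizon
`Y = «⊕P = EXP»` into `ParityHorizon` («NP ⊆ P → ⊕P ≠ EXP», stmt-PneNP-30228) and `ParityDichotomy`
(«NP ⊆ P → ⊕P ⊆ P ∨ ⊕P = EXP», stmt-PneNP-30229).  This file lands the glue item of the split: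
the two children imply the parent, by propositional logic (lens-6 g8 kernel `parityLift_of_split`,
writer certificate `n10_split/N10s_items.lean`).  0 sorry; no axioms beyond the route file's.
-/

namespace Summit.PneNP.PneNP.Theorems

/-- Glue of the N10 split (stmt-PneNP-30230): `ParityHorizon → ParityDichotomy → ParityLift`.
Under `NP ⊆ P` the dichotomy gives `⊕P ⊆ P` (done) or `⊕P = EXP`, which the horizon piece
excludes.  Pure logic over the route declarations; ported from the lens-6 g8 kernel
`parityLift_of_split` (decomp-pnenp cell, 2026-08-30). -/
theorem parityLiftGlue_proof :
    Summit.PneNP.PneNP.Theses.RootDecompParityCell.ParityLiftGlue := by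
  unfold Summit.PneNP.PneNP.Theses.RootDecompParityCell.ParityLiftGlue
    Summit.PneNP.PneNP.Theses.RootDecompParityCell.ParityHorizon
    Summit.PneNP.PneNP.Theses.RootDecompParityCell.ParityDichotomy
    Summit.PneNP.PneNP.Theses.RootDecompParityCell.ParityLift
  intro hH hD hNP
  rcases hD hNP with h | h
  · exact h
  · exact absurd h (hH hNP)

end Summit.PneNP.PneNP.Theorems
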